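import Summits.QuantumFields.YangMills.Theorems.SourcedPressureJensenSourcedPressureIncrementUniformStability
import Mathlib.Analysis.Calculus.Deriv.MeanValue
import HarnessLib

/-!
# `SourcedPressureIncrement` (stmt-QuantumFields-22517): elementary lemmas for the second-order WINDOW bound of the Gaussian
# sourced increment (companion of `…GaussWindowBound`)

Generic inequalities used by `gauss_increment_window`:

* `exp_le_one_add_add_sq_mul_exp_max` — `e^y ≤ 1 + y + (y²/2)·e^{max(y,0)}` (Taylor, one-sided remainder);
* `abs_centred_mul_centred_le` — `|(S−m)(S'−m)| ≤ ((S+m)+(S'+m))²/2` for `S, S', m ≥ 0`;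
* `pow_four_le_mul_exp` — `z⁴ ≤ 24 s⁻⁴ e^{sz}` (`z ≥ 0`, `s > 0`);
* `log_integral_exp_le` — on a probability space, `log ∫e^Y ≤ ∫Y + ∫(Y²/2)e^{max(Y,0)}`;
* `window_const_bound` — the bookkeeping of the constants.

Everything is proved; no definition, no named fact.  RECORD-label rung support; the Yang–Mills mass gap is NOT proved by anything
here. [folklore]
-/

noncomputable section

open MeasureTheory ProbabilityTheory Real Finset
open Literature.Probability.LatticeModels Literature.MathematicalPhysics.QuantumLattice
open Literature.MathematicalPhysics.QuantumFieldTheory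

namespace Summit.QuantumFields.YangMills.Cruxes.SourcedPressureIncrement.Birth

/-! ### Two elementary real inequalities -/

/-- **Second-order exponential inequality with one-sided remainder**: `e^y ≤ 1 + y + (y²/2)·e^{max(y,0)}` for all real
`y` (Taylor with Lagrange remainder; proved by monotonicity from the sign of the derivative on each half-line). [folklore] -/
theorem exp_le_one_add_add_sq_mul_exp_max (y : ℝ) :
    Real.exp y ≤ 1 + y + y ^ 2 / 2 * Real.exp (max y 0) := by
  rcases le_or_gt 0 y with hy | hy
  · -- `y ≥ 0`: `φ(y) = 1 + y + (y²/2)e^y − e^y` is nondecreasing on `[0, ∞)` and vanishes at `0`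
    rw [max_eq_left hy]
    set φ : ℝ → ℝ := fun t => 1 + t + t ^ 2 / 2 * Real.exp t - Real.exp t with hφ
    have hderiv : ∀ t, HasDerivAt φ (1 + ((2 : ℕ) * t ^ 1 / 2 * Real.exp t + t ^ 2 / 2 * Real.exp t) - Real.exp t) t := by
      intro t
      have h1 : HasDerivAt (fun t : ℝ => t ^ 2 / 2 * Real.exp t)
          ((2 : ℕ) * t ^ 1 / 2 * Real.exp t + t ^ 2 / 2 * Real.exp t) t :=
        ((hasDerivAt_pow 2 t).div_const 2).mul (Real.hasDerivAt_exp t)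
      have h2 : HasDerivAt (fun t : ℝ => 1 + t) 1 t := by
        simpa using (hasDerivAt_id t).const_add 1
      exact (h2.add h1).sub (Real.hasDerivAt_exp t)
    have hmono : MonotoneOn φ (Set.Ici 0) := by
      refine monotoneOn_of_deriv_nonneg (convex_Ici 0) (fun t _ => (hderiv t).continuousAt.continuousWithinAt)
        (fun t _ => (hderiv t).differentiableAt.differentiableWithinAt) fun t ht => ?_
      rw [(hderiv t).deriv]
      have hkey : (1 - t) * Real.exp t ≤ 1 := by
        have h := Real.add_one_le_exp (-t)
        have hpos := Real.exp_pos t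
        calc (1 - t) * Real.exp t ≤ Real.exp (-t) * Real.exp t :=
              mul_le_mul_of_nonneg_right (by linarith) hpos.le
          _ = 1 := by rw [← Real.exp_add]; simp
      have hsq : 0 ≤ t ^ 2 / 2 * Real.exp t := by positivity
      push_cast
      nlinarith [hkey, hsq]
    have h0 : φ 0 = 0 := by simp [hφ]
    have := hmono (Set.mem_Ici.2 le_rfl) (Set.mem_Ici.2 hy) hy
    rw [h0] at this
    simp only [hφ] at this
    linarith
  · -- `y < 0`: `g(y) = 1 + y + y²/2 − e^y` is nonincreasing on `(−∞, 0]` and vanishes at `0`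
    rw [max_eq_right hy.le, Real.exp_zero, mul_one]
    set g : ℝ → ℝ := fun t => 1 + t + t ^ 2 / 2 - Real.exp t with hg
    have hderiv : ∀ t, HasDerivAt g (1 + (2 : ℕ) * t ^ 1 / 2 - Real.exp t) t := by
      intro t
      have h2 : HasDerivAt (fun t : ℝ => 1 + t) 1 t := by
        simpa using (hasDerivAt_id t).const_add 1
      exact (h2.add ((hasDerivAt_pow 2 t).div_const 2)).sub (Real.hasDerivAt_exp t)
    have hanti : AntitoneOn g (Set.Iic 0) := by
      refine antitoneOn_of_deriv_nonpos (convex_Iic 0) (fun t _ => (hderiv t).continuousAt.continuousWithinAt)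
        (fun t _ => (hderiv t).differentiableAt.differentiableWithinAt) fun t _ => ?_
      rw [(hderiv t).deriv]
      have h := Real.add_one_le_exp t
      push_cast
      linarith
    have h0 : g 0 = 0 := by simp [hg]
    have := hanti (Set.mem_Iic.2 hy.le) (Set.mem_Iic.2 le_rfl) hy.le
    rw [h0] at this
    simp only [hg] at this
    linarith

/-- `z⁴ ≤ 24·s⁻⁴·e^{sz}` for `z ≥ 0`, `s > 0` (`(sz)⁴/4! ≤ e^{sz}`). [folklore] -/
theorem pow_four_le_mul_exp {z s : ℝ} (hz : 0 ≤ z) (hs : 0 < s) :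
    z ^ 4 ≤ 24 / s ^ 4 * Real.exp (s * z) := by
  have h := Real.pow_div_factorial_le_exp (s * z) (mul_nonneg hs.le hz) 4
  have h24 : ((Nat.factorial 4 : ℕ) : ℝ) = 24 := by norm_num [Nat.factorial]
  rw [h24, mul_pow, div_le_iff₀ (by norm_num : (0 : ℝ) < 24)] at h
  have hs4 : 0 < s ^ 4 := by positivity
  rw [div_mul_eq_mul_div, le_div_iff₀ hs4]
  nlinarith [h]

/-- `|(S − m)(S' − m)| ≤ ((S + m) + (S' + m))²/2` for `S, S', m ≥ 0`. [folklore] -/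
theorem abs_centred_mul_centred_le {S S' m : ℝ} (hS : 0 ≤ S) (hS' : 0 ≤ S') (hm : 0 ≤ m) :
    |(S - m) * (S' - m)| ≤ ((S + m) + (S' + m)) ^ 2 / 2 := by
  rw [abs_mul]
  have h1 : |S - m| ≤ S + m := abs_sub_le_iff.2 ⟨by linarith, by linarith⟩
  have h2 : |S' - m| ≤ S' + m := abs_sub_le_iff.2 ⟨by linarith, by linarith⟩
  have h3 : |S - m| * |S' - m| ≤ (S + m) * (S' + m) := mul_le_mul h1 h2 (abs_nonneg _) (by linarith)
  nlinarith [sq_nonneg ((S + m) - (S' + m))]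

/-! ### `log E e^Y ≤ E Y + E[(Y²/2) e^{Y₊}]` on a probability space -/

section Prob

variable {α : Type*} [MeasurableSpace α] {μ : Measure α} [IsProbabilityMeasure μ]

/-- **Second-order bound on an exponential moment with one-sided remainder.**  For a probability measure and a real `Y`
with `Y`, `e^Y` and `(Y²/2)e^{max(Y,0)}` integrable: `log ∫ e^Y dμ ≤ ∫ Y dμ + ∫ (Y²/2) e^{max(Y,0)} dμ`
(`e^y ≤ 1 + y + (y²/2)e^{y₊}` integrated, then `log z ≤ z − 1`). [folklore] -/
theorem log_integral_exp_le (Y : α → ℝ) (hY : Integrable Y μ) (heY : Integrable (fun x => Real.exp (Y x)) μ)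
    (hR : Integrable (fun x => Y x ^ 2 / 2 * Real.exp (max (Y x) 0)) μ) :
    Real.log (∫ x, Real.exp (Y x) ∂μ) ≤ ∫ x, Y x ∂μ + ∫ x, Y x ^ 2 / 2 * Real.exp (max (Y x) 0) ∂μ := by
  have hle : ∫ x, Real.exp (Y x) ∂μ ≤ 1 + ∫ x, Y x ∂μ + ∫ x, Y x ^ 2 / 2 * Real.exp (max (Y x) 0) ∂μ := by
    have h01 : Integrable (fun x => (1 : ℝ) + Y x) μ := (integrable_const (1 : ℝ)).add hY
    have h1 : ∫ x, Real.exp (Y x) ∂μ ≤ ∫ x, (1 + Y x + Y x ^ 2 / 2 * Real.exp (max (Y x) 0)) ∂μ :=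
      integral_mono heY (h01.add hR) fun x => exp_le_one_add_add_sq_mul_exp_max (Y x)
    have hsplit : ∫ x, (1 + Y x + Y x ^ 2 / 2 * Real.exp (max (Y x) 0)) ∂μ =
        1 + ∫ x, Y x ∂μ + ∫ x, Y x ^ 2 / 2 * Real.exp (max (Y x) 0) ∂μ := by
      rw [integral_add h01 hR, integral_add (integrable_const (1 : ℝ)) hY]
      simp
    linarith
  have hpos : 0 < ∫ x, Real.exp (Y x) ∂μ := integral_exp_pos heY
  linarith [Real.log_le_sub_one_of_pos hpos]

end Prob

/-! ### The Gaussian sourced increment to second order in the window -/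

/-- The bookkeeping of constants in `gauss_increment_window` (pure real arithmetic, isolated so that the arithmetic
tactics see only opaque real variables). [folklore] -/
theorem window_const_bound {h s s₀ N m t lam c cI cB D' : ℝ}
    (hN1 : 1 ≤ N) (hs : s = s₀ / N) (hs₀ : 0 < s₀) (hm0 : 0 ≤ m) (ht : t = s * lam + c) (ht0 : 0 ≤ t)
    (hsl : s * lam * N ≤ 1 / 8) (hc8 : c * N ≤ 1 / 8) (hcI : cI ≤ 2 * cB * D') (hcBN : cB ≤ N)
    (hD : 0 ≤ D') :
    h ^ 2 / 8 * (24 / s ^ 4) * Real.exp (s * (2 * m * cB)) * Real.exp (t * cI) ≤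
      3 / s₀ ^ 4 * Real.exp (2 * m * s₀ + D' / 2) * h ^ 2 * N ^ 4 := by
  have hNpos : 0 < N := by linarith
  have hspos : 0 < s := by rw [hs]; positivity
  have htN : t * N ≤ 1 / 4 := by rw [ht, add_mul]; linarith
  have htI : t * cI ≤ D' / 2 := by
    have hI2 : cI ≤ 2 * N * D' := hcI.trans (by nlinarith)
    calc t * cI ≤ t * (2 * N * D') := mul_le_mul_of_nonneg_left hI2 ht0
      _ = (t * N) * (2 * D') := by ring
      _ ≤ (1 / 4) * (2 * D') := mul_le_mul_of_nonneg_right htN (by positivity)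
      _ = D' / 2 := by ring
  have hsm : s * (2 * m * cB) ≤ 2 * m * s₀ := by
    have hscB : s * cB ≤ s₀ := by
      rw [hs, div_mul_eq_mul_div, div_le_iff₀ hNpos]
      exact mul_le_mul_of_nonneg_left hcBN hs₀.le
    nlinarith [hscB, hm0]
  have hs4 : 24 / s ^ 4 = 24 * N ^ 4 / s₀ ^ 4 := by
    rw [hs, div_pow]; field_simp
  rw [hs4, mul_assoc (h ^ 2 / 8 * (24 * N ^ 4 / s₀ ^ 4)), ← Real.exp_add]
  have hexp : Real.exp (s * (2 * m * cB) + t * cI) ≤ Real.exp (2 * m * s₀ + D' / 2) :=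
    Real.exp_le_exp.2 (add_le_add hsm htI)
  have hcoef : 0 ≤ h ^ 2 / 8 * (24 * N ^ 4 / s₀ ^ 4) := by positivity
  calc h ^ 2 / 8 * (24 * N ^ 4 / s₀ ^ 4) * Real.exp (s * (2 * m * cB) + t * cI)
      ≤ h ^ 2 / 8 * (24 * N ^ 4 / s₀ ^ 4) * Real.exp (2 * m * s₀ + D' / 2) := mul_le_mul_of_nonneg_left hexp hcoef
    _ = 3 / s₀ ^ 4 * Real.exp (2 * m * s₀ + D' / 2) * h ^ 2 * N ^ 4 := by ring

end Summit.QuantumFields.YangMills.Cruxes.SourcedPressureIncrement.Birth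

end
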